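import Mathlib
import Literature.Analysis.FluidPDE.VectorCalculus
import Summits.NavierStokesRegularity.NavierStokesRegularity.Theorems.UnthreadedDoorFluxStarvedDipoleGeneralLeverIdentities
import Summits.NavierStokesRegularity.NavierStokesRegularity.Theorems.UnthreadedDoorFluxStarvedDipoleAmplitudeLaw
import Summits.NavierStokesRegularity.NavierStokesRegularity.Theorems.UnthreadedDoorFluxStarvedDipoleTangencyOfZeroFlux
import Summits.NavierStokesRegularity.NavierStokesRegularity.Theorems.UnthreadedDoorFluxStarvedDipoleZeroNetFlux
import HarnessLib

/-!
# Route `UnthreadedDoor`, crux `PoloidalLiouville` (stmt-NavierStokesRegularity-1222), wall W1 — crux idea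
# «flux-starved-dipoles» (ns-idea-15 g12/g13, `Cruxes/PoloidalLiouville/FluxStarvedDipoleSketch.lean`):
# the lever for a GENERAL REDUCED SCALAR, II — latitude identity and tangency at non-solid radii

Continuation of `…GeneralLeverIdentities`: the steady proofs of `latitude_identity` (p838473) and `fluxStarvationSteady`
(p838510) with the reduced scalar `L = ⟪u,∇T⟫ − Ψ`, `Ψ` differentiable off the centre and `Ψ = ΔT + (affine)` on `S_r(x₀)`
(for the time-dependent law (E1), `Ψ = ΔT − ∂ₜT`):

* `latitude_identity_gen` — `(a − r⟪A′(r), n⟫)·M = −r³⟪Cv, n⟫` on every non-polar latitude circle;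
* `tangent_of_nonSolid_gen` — at a non-solid radius (`A(r) ≠ 0`, `r(‖A‖)′(r) ≠ ‖A(r)‖`) a `C¹` incompressible drift obeying the
  law is tangent to `S_r(x₀)` (the affine perturbation only shifts `Cv`, so the loop momentum is still latitude-independent, and
  zero net flux makes it vanish).

HONEST LABEL: linear kinematic shadow of W1 (critic V28: information-grade, W1 movement 0); `PoloidalLiouville` (1222), its wall
`stub_scalarLiouville` and the summit stay OPEN; NO Navier–Stokes regularity statement is proved.
`--supports stmt-NavierStokesRegularity-1222` (helper).  [folklore]
-/

noncomputable section

-- the summit and its single sub-problem share the name (CONVENTIONS §1)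
set_option linter.dupNamespace false

open Set Filter Topology InnerProductSpace
open scoped RealInnerProductSpace Laplacian
open Literature.Analysis.FluidPDE
open Summit.NavierStokesRegularity.NavierStokesRegularity.Theorems.PoloidalLiouville.HorizonTower (E3)
open Summit.NavierStokesRegularity.NavierStokesRegularity.Theorems.PoloidalLiouville.KinematicShadow (PointSource.cross_smul_right
  PointSource.cross_add_right PointSource.cross_self PointSource.cross_anticomm)
open Summit.NavierStokesRegularity.NavierStokesRegularity.Theorems.PoloidalLiouville.HorizonTower.Zonal (inner_cross_self_left
  inner_cross_self_right norm_cross_sq cross_cross_left_of_orthonormal cross_cross_right_of_orthonormal frameBasis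
  frameBasis_apply frameVec_zero frameVec_one frameVec_two)

namespace Summit.NavierStokesRegularity.NavierStokesRegularity.Theorems.PoloidalLiouville.FluxStarvedDipole

/-! ### The latitude-independence identity (incompressibility averaged over a latitude circle) -/

/-- **LATITUDE-INDEPENDENCE IDENTITY, general reduced scalar** (as `latitude_identity`, p838473, with `Ψ` for `ΔT`; crux card «flux-starved-dipoles», §Proof step 3, the identity `(a − r a′)·M = −r²ℓ`).
Setting: `u ∈ C¹` divergence-free, `A, R ∈ C³(0,∞)`, the steady kinematic law for the dipole potential off the centre, `r > 0`,
`A(r) = a·n`, `a = ‖A(r)‖ ≠ 0`, `e ⊥ n` a unit vector, `ΔT(x₀ + y) = ⟪Cv, y⟫ + D` on `S_r`.  On the NON-POLAR latitude circle of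
colatitude `θ` (`sin θ ≠ 0`) the loop momentum `M = ⟪u, x − x₀⟫` (constant there by the loop law) satisfies
`(a − r⟪A′(r), n⟫)·M = −r³⟪Cv, n⟫` — independent of `θ`.
Proof: along the circle `φ ↦ x₀ + r cos θ·n + r sin θ·(cos φ·e + sin φ·(n × e))`, `d/dφ ⟪u, φ̂⟫ = r sin θ⟪φ̂, Du φ̂⟫ − ⟪u, ρ̂⟫`;
by `azimuthal_identity` and the loop law, `r a·d/dφ ⟪u, φ̂⟫ = K₀ + K₁ cos φ + K₂ sin φ` with
`K₀ = sin θ·(−aM + r⟪A′,n⟫M − r³⟪Cv,n⟫)`; integrating over `[0, 2π]` gives `K₀ = 0`. [folklore] -/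
theorem latitude_identity_gen (u : E3 → E3) (x₀ : E3) (A : ℝ → E3) (R : ℝ → ℝ)
    (hu : ContDiff ℝ 1 u) (hdiv : Literature.Analysis.FluidPDE.VectorCalculus.IsDivFree u)
    (hA : ContDiffOn ℝ 3 A (Set.Ioi 0)) (hR : ContDiffOn ℝ 3 R (Set.Ioi 0)) {Ψ : E3 → ℝ}
    (hlaw : ∀ x ∈ ({x₀}ᶜ : Set E3),
      cross (gradient (fun z => ⟪u z, gradient (fun x => ⟪A ‖x - x₀‖, x - x₀⟫ / ‖x - x₀‖ + R ‖x - x₀‖) z⟫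
          - Ψ z) x) (x - x₀)
        = cross (gradient (fun z => ⟪u z, z - x₀⟫) x)
            (gradient (fun x => ⟪A ‖x - x₀‖, x - x₀⟫ / ‖x - x₀‖ + R ‖x - x₀‖) x))
    {r : ℝ} (hr : 0 < r) (hAr : A r ≠ 0) {n e : E3} (hn : ‖n‖ = 1) (hAn : A r = ‖A r‖ • n) (he : ‖e‖ = 1)
    (hne : ⟪n, e⟫ = 0) {Cv : E3} {D : ℝ}
    (hΨd : ∀ x : E3, x ≠ x₀ → DifferentiableAt ℝ Ψ x) (hQ : ∀ y : E3, ‖y‖ = r → Ψ (x₀ + y) = ⟪Cv, y⟫ + D)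
    {θ : ℝ} (hθ : Real.sin θ ≠ 0) :
    (‖A r‖ - r * ⟪deriv A r, n⟫) *
        ⟪u (x₀ + ((r * Real.cos θ) • n + (r * Real.sin θ) • e)), (r * Real.cos θ) • n + (r * Real.sin θ) • e⟫
      = -(r ^ 3 * ⟪Cv, n⟫) := by
  set a : ℝ := ‖A r‖ with ha
  have ha0 : a ≠ 0 := norm_ne_zero_iff.mpr hAr
  set c : ℝ := Real.cos θ with hc
  set s : ℝ := Real.sin θ with hs
  have hcs : c ^ 2 + s ^ 2 = 1 := Real.cos_sq_add_sin_sq θ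
  -- the frame `(n, e, n × e)`
  obtain ⟨hf1, hfn, hfe, hnf, -⟩ := pairFrame_facts hn he hne
  have hnf' : ⟪n, cross n e⟫ = 0 := by rw [real_inner_comm]; exact hfn
  have hef' : ⟪e, cross n e⟫ = 0 := by rw [real_inner_comm]; exact hfe
  -- the rotating unit vectors `ρ̂(φ)`, `φ̂(φ)`
  set ρf : ℝ → E3 := fun φ => Real.cos φ • e + Real.sin φ • cross n e with hρf
  set pf : ℝ → E3 := fun φ => (-Real.sin φ) • e + Real.cos φ • cross n e with hpf
  have hρ1 : ∀ φ, ‖ρf φ‖ = 1 := fun φ => (movingFrame_facts he hf1 hef' (Real.cos_sq_add_sin_sq φ)).1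
  have hnρ : ∀ φ, ⟪n, ρf φ⟫ = 0 := fun φ => by
    simp only [hρf, inner_add_right, inner_smul_right, hne, hnf', mul_zero, add_zero]
  have hnρx : ∀ φ, cross n (ρf φ) = pf φ := fun φ => by
    simp only [hρf, hpf, PointSource.cross_add_right, PointSource.cross_smul_right, hnf]
    module
  have hpf' : ∀ φ, HasDerivAt pf (-(Real.cos φ • e + Real.sin φ • cross n e)) φ := fun φ =>
    hasDerivAt_thetaHat e (cross n e) φ
  -- the latitude circle and the loop momentum on it
  set γ : ℝ → E3 := fun φ => x₀ + (r * c) • n + (r * s) • (Real.cos φ • e + Real.sin φ • cross n e) with hγ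
  have hγ' : ∀ φ, HasDerivAt γ ((r * s) • pf φ) φ := fun φ => hasDerivAt_latitudeCircle n e x₀ r c s φ
  have hγx : ∀ φ, γ φ = x₀ + ((r * c) • n + (r * s) • ρf φ) := fun φ => add_assoc _ _ _
  have hγy : ∀ φ, γ φ - x₀ = r • (c • n + s • ρf φ) := fun φ => by
    rw [hγx, add_sub_cancel_left]; simp only [hρf]; module
  set M : ℝ := ⟪u (x₀ + ((r * c) • n + (r * s) • e)), (r * c) • n + (r * s) • e⟫ with hM
  have hn' : ‖A r‖⁻¹ • A r = n := by
    nth_rewrite 2 [hAn]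
    rw [smul_smul, inv_mul_cancel₀ ha0, one_smul]
  have hAe : ⟪A r, e⟫ = 0 := by rw [hAn, real_inner_smul_left, hne, mul_zero]
  have hγ0 : γ 0 = x₀ + ((r * c) • n + (r * s) • e) := by
    rw [hγx]; simp only [hρf, Real.cos_zero, Real.sin_zero, one_smul, zero_smul, add_zero]
  have hm : ∀ φ, ⟪u (γ φ), γ φ - x₀⟫ = M := by
    intro φ
    have h : ⟪u (γ φ), γ φ - x₀⟫ = ⟪u (γ 0), γ 0 - x₀⟫ := by
      have h0 := loopMomentum_const_on_latitudeCircle_gen u x₀ A R hu hA hR hlaw hr hAr he hAe hcs φ 0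
      rw [hn'] at h0
      exact h0
    rw [h, hγ0, add_sub_cancel_left]
  have hMξ : ∀ φ, r * ⟪u (γ φ), c • n + s • ρf φ⟫ = M := fun φ => by
    rw [← hm φ, hγy, inner_smul_right]
  -- the azimuthal strain identity at each point of the circle
  have hP : ∀ φ, a * (r * s) * ⟪pf φ, fderiv ℝ u (γ φ) (pf φ)⟫ =
      a * c * ⟪u (γ φ), (-s) • n + c • ρf φ⟫ - ⟪deriv A r, (-s) • n + c • ρf φ⟫ * M
        + r ^ 2 * ⟪Cv, (-s) • n + c • ρf φ⟫ := by
    intro φ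
    have h := azimuthal_identity_gen u x₀ A R hu hdiv hA hR hlaw hr hn hAn (hρ1 φ) (hnρ φ) hΨd hQ θ (hγx φ) rfl rfl
    rw [hnρx, hm] at h
    exact h
  -- the derivative of `φ ↦ r a ⟪u, φ̂⟫` along the circle is `K₀ + K₁ cos φ + K₂ sin φ`
  set K₀ : ℝ := s * (-(a * M) + r * ⟪deriv A r, n⟫ * M - r ^ 3 * ⟪Cv, n⟫) with hK₀
  set K₁ : ℝ := r * c * (-(⟪deriv A r, e⟫ * M) + r ^ 2 * ⟪Cv, e⟫) with hK₁
  set K₂ : ℝ := r * c * (-(⟪deriv A r, cross n e⟫ * M) + r ^ 2 * ⟪Cv, cross n e⟫) with hK₂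
  have hderiv : ∀ φ, HasDerivAt (fun φ => r * (a * ⟪u (γ φ), pf φ⟫)) (K₀ + K₁ * Real.cos φ + K₂ * Real.sin φ) φ := by
    intro φ
    have hU : HasDerivAt (fun φ => u (γ φ)) (fderiv ℝ u (γ φ) ((r * s) • pf φ)) φ :=
      (hu.differentiable one_ne_zero (γ φ)).hasFDerivAt.comp_hasDerivAt φ (hγ' φ)
    have h := ((hU.inner ℝ (hpf' φ)).const_mul a).const_mul r
    refine h.congr_deriv ?_
    have hρdec : Real.cos φ • e + Real.sin φ • cross n e
        = s • (c • n + s • ρf φ) + c • ((-s) • n + c • ρf φ) := by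
      have h1 : s • (c • n + s • ρf φ) + c • ((-s) • n + c • ρf φ) = (c ^ 2 + s ^ 2) • ρf φ := by
        simp only [hρf]; module
      rw [h1, hcs, one_smul]
    rw [map_smul, real_inner_smul_left, real_inner_comm (pf φ) (fderiv ℝ u (γ φ) (pf φ)), inner_neg_right, hρdec,
      inner_add_right, inner_smul_right, inner_smul_right]
    have hPφ := hP φ
    have hMφ := hMξ φ
    simp only [hρf, inner_add_right, inner_smul_right] at hPφ hMφ ⊢
    linear_combination r * hPφ - a * s * hMφ
  -- integrate over `[0, 2π]`
  have hint : ∫ φ in (0 : ℝ)..2 * Real.pi, (K₀ + K₁ * Real.cos φ + K₂ * Real.sin φ) =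
      r * (a * ⟪u (γ (2 * Real.pi)), pf (2 * Real.pi)⟫) - r * (a * ⟪u (γ 0), pf 0⟫) :=
    intervalIntegral.integral_eq_sub_of_hasDerivAt (fun φ _ => hderiv φ)
      ((by fun_prop : Continuous fun φ => K₀ + K₁ * Real.cos φ + K₂ * Real.sin φ).intervalIntegrable _ _)
  have hper : r * (a * ⟪u (γ (2 * Real.pi)), pf (2 * Real.pi)⟫) - r * (a * ⟪u (γ 0), pf 0⟫) = 0 := by
    simp only [hγ, hpf, Real.cos_two_pi, Real.sin_two_pi, Real.cos_zero, Real.sin_zero, sub_self]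
  have hval : ∫ φ in (0 : ℝ)..2 * Real.pi, (K₀ + K₁ * Real.cos φ + K₂ * Real.sin φ) = 2 * Real.pi * K₀ := by
    rw [intervalIntegral.integral_add, intervalIntegral.integral_add, intervalIntegral.integral_const,
      intervalIntegral.integral_const_mul, intervalIntegral.integral_const_mul, integral_cos, integral_sin]
    · simp only [Real.sin_two_pi, Real.sin_zero, Real.cos_two_pi, Real.cos_zero, sub_self, mul_zero, add_zero,
        sub_zero, smul_eq_mul]
    · exact continuous_const.intervalIntegrable _ _
    · exact (continuous_const.mul Real.continuous_cos).intervalIntegrable _ _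
    · exact (continuous_const.add (continuous_const.mul Real.continuous_cos)).intervalIntegrable _ _
    · exact (continuous_const.mul Real.continuous_sin).intervalIntegrable _ _
  rw [hval, hper] at hint
  have hK : K₀ = 0 := by
    rcases mul_eq_zero.mp hint with h | h
    · exact absurd h (by positivity)
    · exact h
  rw [hK₀] at hK
  rcases mul_eq_zero.mp hK with h | h
  · exact absurd h hθ
  · linear_combination (-1 : ℝ) * h

/-! ### Tangency at non-solid radii -/

/-- **TANGENCY AT NON-SOLID RADII, general reduced scalar.**  As `fluxStarvationSteady` (p838510) at one radius, for the law
`∇(⟪u,∇T⟫ − Ψ) × (x−x₀) = ∇⟪u, x−x₀⟫ × ∇T` with `Ψ = ΔT + (affine on S_r)` differentiable off the centre (the time-dependent law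
has `Ψ = ΔT − ∂ₜT`): a `C¹` incompressible drift is tangent to the non-solid dipolar sphere `S_r(x₀)`. [folklore] -/
theorem tangent_of_nonSolid_gen (u : E3 → E3) (x₀ : E3) (A : ℝ → E3) (R : ℝ → ℝ)
    (hu : ContDiff ℝ 1 u) (hdiv : Literature.Analysis.FluidPDE.VectorCalculus.IsDivFree u)
    (hA : ContDiffOn ℝ 3 A (Set.Ioi 0)) (hR : ContDiffOn ℝ 3 R (Set.Ioi 0)) {Ψ : E3 → ℝ}
    (hlaw : ∀ x ∈ ({x₀}ᶜ : Set E3),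
      cross (gradient (fun z => ⟪u z, gradient (fun x => ⟪A ‖x - x₀‖, x - x₀⟫ / ‖x - x₀‖ + R ‖x - x₀‖) z⟫
          - Ψ z) x) (x - x₀)
        = cross (gradient (fun z => ⟪u z, z - x₀⟫) x)
            (gradient (fun x => ⟪A ‖x - x₀‖, x - x₀⟫ / ‖x - x₀‖ + R ‖x - x₀‖) x))
    {r : ℝ} (hr : 0 < r) (hAr : A r ≠ 0) (hsol : r * deriv (fun s => ‖A s‖) r ≠ ‖A r‖)
    (hΨd : ∀ x : E3, x ≠ x₀ → DifferentiableAt ℝ Ψ x) {W : E3} {D' : ℝ}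
    (hΨ : ∀ y : E3, ‖y‖ = r →
      Ψ (x₀ + y) = Δ (fun x => ⟪A ‖x - x₀‖, x - x₀⟫ / ‖x - x₀‖ + R ‖x - x₀‖) (x₀ + y) + ⟪W, y⟫ + D') :
    ∀ x, ‖x - x₀‖ = r → ⟪u x, x - x₀⟫ = 0 := by
  set T : E3 → ℝ := fun x => ⟪A ‖x - x₀‖, x - x₀⟫ / ‖x - x₀‖ + R ‖x - x₀‖ with hTdef
  have hT : ∀ z, T z = ⟪A ‖z - x₀‖, z - x₀⟫ / ‖z - x₀‖ + R ‖z - x₀‖ := fun z => rfl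
  -- the unit axis `n = Â(r)`
  have hAn0 : ‖A r‖ ≠ 0 := norm_ne_zero_iff.mpr hAr
  obtain ⟨n, hn_def⟩ : ∃ n : E3, n = ‖A r‖⁻¹ • A r := ⟨_, rfl⟩
  have hn1 : ‖n‖ = 1 := by rw [hn_def, norm_smul, norm_inv, norm_norm, inv_mul_cancel₀ hAn0]
  have hAn : A r = ‖A r‖ • n := by rw [hn_def, smul_smul, mul_inv_cancel₀ hAn0, one_smul]
  -- the Laplacian of `T` on `S_r` in a radial frame: `ΔT(x₀ + y) = ⟪Cv, y⟫ + D`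
  obtain ⟨b, hb0, -, hb1, hb2⟩ := NetFlux.exists_orthonormalBasis_radial hn1
  obtain ⟨C, D, -, hΔ⟩ := dipole_laplacian_sphere hT hA hR b hr
  obtain ⟨Cv, hCv⟩ : ∃ Cv : E3, Cv = (∑ i, C i • b i) + W := ⟨_, rfl⟩
  have hQ : ∀ y : E3, ‖y‖ = r → Ψ (x₀ + y) = ⟪Cv, y⟫ + (D + D') := by
    intro y hy
    rw [hΨ y hy, hΔ y hy, hCv, inner_add_left, sum_inner]
    simp only [real_inner_smul_left, mul_comm]
    ring
  -- the derivative of the moment size and the non-solidity defect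
  have hA1 : DifferentiableAt ℝ A r := (hA.differentiableOn (by norm_num)).differentiableAt (Ioi_mem_nhds hr)
  have ha' : deriv (fun s => ‖A s‖) r = ⟪deriv A r, n⟫ := by rw [deriv_norm_eq_inner_unit hA1 hAr, hn_def]
  have hden : ‖A r‖ - r * ⟪deriv A r, n⟫ ≠ 0 := by
    rw [← ha']
    intro h
    exact hsol (by linarith)
  obtain ⟨K, hK⟩ : ∃ K : ℝ, K = -(r ^ 3 * ⟪Cv, n⟫) / (‖A r‖ - r * ⟪deriv A r, n⟫) := ⟨_, rfl⟩
  -- (1) on every NON-POLAR latitude circle the loop momentum equals `K`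
  have hlat : ∀ e : E3, ‖e‖ = 1 → ⟪n, e⟫ = 0 → ∀ θ : ℝ, Real.sin θ ≠ 0 →
      ⟪u (x₀ + ((r * Real.cos θ) • n + (r * Real.sin θ) • e)), (r * Real.cos θ) • n + (r * Real.sin θ) • e⟫ = K := by
    intro e he hne θ hθ
    have h := latitude_identity_gen u x₀ A R hu hdiv hA hR hlaw hr hAr hn1 hAn he hne hΨd hQ hθ
    rw [hK, eq_div_iff hden]
    linear_combination h
  -- (2) at the poles too, by continuity in the colatitude
  have hall : ∀ e : E3, ‖e‖ = 1 → ⟪n, e⟫ = 0 → ∀ θ : ℝ,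
      ⟪u (x₀ + ((r * Real.cos θ) • n + (r * Real.sin θ) • e)), (r * Real.cos θ) • n + (r * Real.sin θ) • e⟫ = K := by
    intro e he hne θ
    by_cases hθ : Real.sin θ = 0
    swap
    · exact hlat e he hne θ hθ
    have hy : Continuous fun θ' : ℝ => (r * Real.cos θ') • n + (r * Real.sin θ') • e := by fun_prop
    have hgc : Continuous fun θ' : ℝ =>
        ⟪u (x₀ + ((r * Real.cos θ') • n + (r * Real.sin θ') • e)), (r * Real.cos θ') • n + (r * Real.sin θ') • e⟫ :=
      (hu.continuous.comp (continuous_const.add hy)).inner hy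
    have hcos : Real.cos θ ≠ 0 := by
      intro h0
      have h1 := Real.cos_sq_add_sin_sq θ
      rw [h0, hθ] at h1
      norm_num at h1
    have hev : ∀ᶠ θ' in 𝓝[≠] θ, Real.sin θ' ≠ 0 := (Real.hasDerivAt_sin θ).eventually_ne hcos
    have hev' : ∀ᶠ θ' in 𝓝[≠] θ,
        ⟪u (x₀ + ((r * Real.cos θ') • n + (r * Real.sin θ') • e)), (r * Real.cos θ') • n + (r * Real.sin θ') • e⟫ = K :=
      hev.mono fun θ' h => hlat e he hne θ' h
    have h1 := (hgc.tendsto θ).mono_left (nhdsWithin_le_nhds (s := ({θ}ᶜ : Set ℝ)))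
    have h2 : Tendsto (fun θ' : ℝ =>
        ⟪u (x₀ + ((r * Real.cos θ') • n + (r * Real.sin θ') • e)), (r * Real.cos θ') • n + (r * Real.sin θ') • e⟫)
        (𝓝[≠] θ) (𝓝 K) := (tendsto_congr' hev').mpr tendsto_const_nhds
    exact tendsto_nhds_unique h1 h2
  -- (3) every point of `S_r(x₀)` lies on a latitude circle
  have hconst : ∀ x : E3, ‖x - x₀‖ = r → ⟪u x, x - x₀⟫ = K := by
    intro x hx
    obtain ⟨y, hy⟩ : ∃ y : E3, y = x - x₀ := ⟨_, rfl⟩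
    have hyn : ‖y‖ = r := by rw [hy, hx]
    obtain ⟨w, hw⟩ : ∃ w : E3, w = y - ⟪n, y⟫ • n := ⟨_, rfl⟩
    have hnw : ⟪n, w⟫ = 0 := by
      rw [hw, inner_sub_right, inner_smul_right, real_inner_self_eq_norm_sq, hn1]; ring
    -- a unit vector `e ⊥ n` with `w = ‖w‖ e`
    obtain ⟨e, he, hne, hwe⟩ : ∃ e : E3, ‖e‖ = 1 ∧ ⟪n, e⟫ = 0 ∧ w = ‖w‖ • e := by
      by_cases hw0 : w = 0
      · obtain ⟨e, he, hen⟩ := NetFlux.exists_unit_orth n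
        exact ⟨e, he, by rw [real_inner_comm]; exact hen, by rw [hw0, norm_zero, zero_smul]⟩
      · have hw1 : ‖w‖ ≠ 0 := norm_ne_zero_iff.mpr hw0
        exact ⟨‖w‖⁻¹ • w, by rw [norm_smul, norm_inv, norm_norm, inv_mul_cancel₀ hw1],
          by rw [inner_smul_right, hnw, mul_zero], by rw [smul_smul, mul_inv_cancel₀ hw1, one_smul]⟩
    -- the colatitude `θ = arccos(⟪n, y⟫/r)`
    have hc1 : |⟪n, y⟫ / r| ≤ 1 := by
      rw [abs_div, abs_of_pos hr, div_le_one hr]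
      calc |⟪n, y⟫| ≤ ‖n‖ * ‖y‖ := abs_real_inner_le_norm _ _
        _ = r := by rw [hn1, hyn, one_mul]
    obtain ⟨θ, hθ⟩ : ∃ θ : ℝ, θ = Real.arccos (⟪n, y⟫ / r) := ⟨_, rfl⟩
    have hcos : Real.cos θ = ⟪n, y⟫ / r := by
      rw [hθ]
      exact Real.cos_arccos (abs_le.mp hc1).1 (abs_le.mp hc1).2
    have hw2 : ‖w‖ ^ 2 = r ^ 2 - ⟪n, y⟫ ^ 2 := by
      rw [hw, ← real_inner_self_eq_norm_sq, inner_sub_left, inner_sub_right, inner_sub_right, real_inner_smul_left,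
        real_inner_smul_right, real_inner_smul_left, real_inner_smul_right, real_inner_self_eq_norm_sq,
        real_inner_self_eq_norm_sq, hn1, hyn, real_inner_comm y n]
      ring
    have hsin : Real.sin θ = ‖w‖ / r := by
      rw [hθ, Real.sin_arccos]
      have h3 : 1 - (⟪n, y⟫ / r) ^ 2 = (‖w‖ / r) ^ 2 := by
        rw [div_pow, div_pow, hw2]
        field_simp
      rw [h3, Real.sqrt_sq (div_nonneg (norm_nonneg _) hr.le)]
    have hyeq : y = (r * Real.cos θ) • n + (r * Real.sin θ) • e := by
      rw [hcos, hsin, mul_div_cancel₀ _ hr.ne', mul_div_cancel₀ _ hr.ne', ← hwe, hw, add_sub_cancel]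
    have hxeq : x = x₀ + ((r * Real.cos θ) • n + (r * Real.sin θ) • e) := by
      rw [← hyeq, hy, add_sub_cancel]
    have h := hall e he hne θ
    rw [← hxeq] at h
    rw [← hy, hyeq]
    exact h
  -- (4) zero net flux through `S_r(x₀)` ⇒ the constant is zero
  exact tangent_of_loopMomentum_const_of_zeroFlux u x₀ hr (fun x y hx hy => by rw [hconst x hx, hconst y hy])
    (sphereFlux_eq_zero_of_divFree u hu hdiv x₀ hr)


end Summit.NavierStokesRegularity.NavierStokesRegularity.Theorems.PoloidalLiouville.FluxStarvedDipole

end
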